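import Mathlib
import HarnessLib
import Literature.MathematicalPhysics.StatisticalMechanics.LennardJonesClusters
import Literature.MathematicalPhysics.StatisticalMechanics.LennardJonesThermodynamicLimitProofs
import Summits.AtomisticToContinuum.Crystallization.Theorems.LoopTunnelDialLocalSurgery

/-!
# LoopTunnelDial — the ORDER-ONE RUNG of the NEAR surgery floor on crux `PocketCase` (stmt-AtomisticToContinuum-27294)

decomp-a2c lens-5 «finite/base range + asymptotic regime + bridge», generation 14; `--supports stmt-AtomisticToContinuum-27294 --as helper`.
Companion of the landed helper `Theorems.LoopTunnelDialLocalSurgery` (p782887): there the LOCAL-SURGERY currency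
«`Improvable e η R y c`» (∃ injective `z` equal to `y` as a point set outside the closed `R`-ball about `y c`, `|M − N| ≤ ⌈64R³⌉`,
`𝓔(z) + η ≤ 𝓔(y) + e·(M − N)`) and its bridge atom were landed; here the FIRST RUNG of the NEAR floor in that currency is PROVED —
the texture class «the pocket carries an ORDER-ONE DEFECT at certified thresholds»:

  `OrderOneDefect R y c` :≡ (H) an empty point `q` within `R` of `y c`, clear of particles within `9/10`, with at least `10` particles in the
                            contact window `[39/40, 103/100]` (a VACANCY / DIVACANCY / TRIVACANCY-caged hole), or
                        (L) a particle `i` within `R` of `y c` with site energy `𝓔ⁱ(y) ≥ 1/100` (an INTERSTITIAL / crowdion / hot debris site).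

MAIN THEOREM `orderOne_floor` (sequence level, GS-FREE — only injectivity of the configurations and the level `e = lim E(N)/N` are used):
for EVERY sequence of injective configurations, with margin `η = 1/100` and from radius `R₁ = 1` on, at every index, an order-one defect
within `R` of some particle makes the configuration radius-`R` improvable by `η` about that particle:

  `∃ η R₁, 0 < η ∧ ∀ e, E(N)/N → e → ∀ R ≥ R₁, ∀ᶠ N, (∃ c, OrderOneDefect R (x N) c) → ∃ c, Improvable e η R (x N) c`   (all unfolded).

This is LITERALLY the shape of the line's NEAR♯ floor `FloorEvI x trig` (PREVIEW v4 «pocket-surgery», HOME/decomp-a2c-lens-5/g14/preview)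
for the sub-trigger `trig R N y := ∃ c, OrderOneDefect R y c`; by the line's `floorEvI_mono`, NEAR♯ restricted to near pockets that carry an
order-one defect within `R` of a particle is THEREBY PROVED — the point-defect-gas texture of the NEAR world (census l.913's vacancy
superlattices, interstitial debris) is discharged by theorem, before any census number.

INGREDIENTS (all certified, no `e⋆` precision): the level floor `−0.78647722 ≤ e` (`LoopTunnelDialLocalSurgery.twoConeB_le_of_tendsto`,
from the landed TwoConeSA stability bound) for (H): `Σ_i V(|q − y_i|) ≤ −(2/25)·10 = −4/5 ≤ e − 1/100` (`insertion_le_of_clear`); the level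
CEILING `e ≤ 0` (`level_nonpos_of_tendsto`, from Literature's subadditivity `E(M+N) ≤ E(M)+E(N)` with `E(0) = E(1) = 0`) for (L):
`e + 1/100 ≤ 1/100 ≤ 𝓔ⁱ(y)`; and the landed one-particle surgeries `improvable_of_insertion_le` / `improvable_of_le_siteEnergy`.

§1 config-wise: `improvable_of_cagedHole`, `improvable_of_hotSite`; §2 the level ceiling `level_nonpos_of_tendsto`; §3 `orderOne_floor`.
No new `def` (D-0009): `OrderOneDefect` and `Improvable` are written unfolded.
-/

open scoped BigOperators Classical Topology
open Filter
open Literature.MathematicalPhysics.StatisticalMechanics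
open Summit.AtomisticToContinuum.Crystallization.Theorems.GrainPercolationDialCrossCeiling (E3)
open Summit.AtomisticToContinuum.Crystallization.Theorems.LoopTunnelDialLocalSurgery

namespace Summit.AtomisticToContinuum.Crystallization.Theorems.LoopTunnelDialOrderOneRung

variable {N : ℕ}

/-! ## §1 Configuration-wise: order-one defects are local improvements at certified thresholds -/

/-- **A CAGED HOLE is a radius-`R` improvement (PROVED, GS-free):** an empty point `q` within `R` of `y c`, clear of particles within `9/10`,
with at least `10` particles in the contact window `[39/40, 103/100]`, at any level `e ≥ −0.78647722` and margin `η ≤ 1/100`: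
filling `q` gains `≥ η` (each window particle binds by `≥ 2/25`, every other clear particle by `≥ 0`). -/
theorem improvable_of_cagedHole {y : Fin N → E3} (hy : Function.Injective y) {R : ℝ} (hR : 0 < R) {q : E3} {c : Fin N}
    (hqc : dist q (y c) ≤ R) (hclear : ∀ k : Fin N, 9 / 10 ≤ dist q (y k))
    (hcaged : 10 ≤ (Finset.univ.filter fun k : Fin N => 39 / 40 ≤ dist q (y k) ∧ dist q (y k) ≤ 103 / 100).card)
    {e η : ℝ} (he : -(98309653 / 125000000 : ℝ) ≤ e) (hη : η ≤ 1 / 100) :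
    ∃ (M : ℕ) (z : Fin M → E3), Function.Injective z ∧
      (∀ k : Fin N, R < dist (y k) (y c) → y k ∈ Set.range z) ∧
      (∀ l : Fin M, R < dist (z l) (y c) → z l ∈ Set.range y) ∧
      N ≤ M + ⌈64 * R ^ 3⌉₊ ∧ M ≤ N + ⌈64 * R ^ 3⌉₊ ∧
      interactionEnergy lennardJones z + η ≤ interactionEnergy lennardJones y + e * ((M : ℝ) - N) := by
  have hq : q ∉ Set.range y := by
    rintro ⟨k, hk⟩
    have h := hclear k
    rw [hk, dist_self] at h
    norm_num at h
  have hsum := insertion_le_of_clear (y := y) (q := q) hclear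
  have hT : (10 : ℝ) ≤ ((Finset.univ.filter fun k : Fin N => 39 / 40 ≤ dist q (y k) ∧ dist q (y k) ≤ 103 / 100).card : ℝ) := by
    exact_mod_cast hcaged
  exact improvable_of_insertion_le hy hR hq hqc (by nlinarith)

/-- **A HOT SITE is a radius-`R` improvement (PROVED, GS-free):** a particle `i` within `R` of `y c` with site energy `≥ 1/100`, at any
level `e ≤ 0` and margin `η ≤ 1/100`: deleting it gains `≥ η`. -/
theorem improvable_of_hotSite {y : Fin N → E3} (hy : Function.Injective y) {R : ℝ} (hR : 0 < R) {i c : Fin N}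
    (hic : dist (y i) (y c) ≤ R) (hhot : 1 / 100 ≤ siteEnergy lennardJones y i)
    {e η : ℝ} (he : e ≤ 0) (hη : η ≤ 1 / 100) :
    ∃ (M : ℕ) (z : Fin M → E3), Function.Injective z ∧
      (∀ k : Fin N, R < dist (y k) (y c) → y k ∈ Set.range z) ∧
      (∀ l : Fin M, R < dist (z l) (y c) → z l ∈ Set.range y) ∧
      N ≤ M + ⌈64 * R ^ 3⌉₊ ∧ M ≤ N + ⌈64 * R ^ 3⌉₊ ∧
      interactionEnergy lennardJones z + η ≤ interactionEnergy lennardJones y + e * ((M : ℝ) - N) :=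
  improvable_of_le_siteEnergy hy hR hic (by linarith)

/-! ## §2 The level ceiling `e ≤ 0` -/

/-- **`e ≤ 0` (PROVED):** along `E(N)/N → e`; `E(N) ≤ 0` by Literature's subadditivity `E(N+1) ≤ E(N) + E(1)` with `E(0) = E(1) = 0`. -/
theorem level_nonpos_of_tendsto {e : ℝ} (he : Tendsto (fun N : ℕ => groundStateEnergy lennardJones 3 N / N) atTop (𝓝 e)) : e ≤ 0 := by
  have hsub := subadditive_groundStateEnergy_lennardJones (by norm_num : 0 < 3)
  have h1 : groundStateEnergy lennardJones 3 1 = 0 := groundStateEnergy_of_le_one _ le_rfl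
  have hE : ∀ N : ℕ, groundStateEnergy lennardJones 3 N ≤ 0 := by
    intro N
    induction N with
    | zero => exact le_of_eq (groundStateEnergy_of_le_one _ (by norm_num))
    | succ n ih =>
      have h : groundStateEnergy lennardJones 3 (n + 1) ≤
          groundStateEnergy lennardJones 3 n + groundStateEnergy lennardJones 3 1 := hsub n 1
      rw [h1] at h
      linarith
  refine le_of_tendsto he (Filter.Eventually.of_forall fun N => ?_)
  rcases Nat.eq_zero_or_pos N with hN | hN
  · subst hN; simp
  · exact div_nonpos_of_nonpos_of_nonneg (hE N) (Nat.cast_nonneg N)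

/-! ## §3 The order-one rung of the NEAR surgery floor (sequence level, GS-free) -/

/-- **ORDER-ONE RUNG (PROVED, GS-free):** for every sequence of injective configurations, with margin `η = 1/100`, from radius `1` on, at
every index: an ORDER-ONE DEFECT (caged hole (H) or hot site (L), thresholds certified) within `R` of some particle makes the configuration
radius-`R` IMPROVABLE by `η` about that particle, at the level `e = lim E(N)/N`.  The statement is the line's `FloorEvI x trig` unfolded,
for `trig R N y := ∃ c, OrderOneDefect R y c`. -/
theorem orderOne_floor (x : (N : ℕ) → (Fin N → E3)) (hx : ∀ N, Function.Injective (x N)) :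
    ∃ η R₁ : ℝ, 0 < η ∧ ∀ e : ℝ, Tendsto (fun N : ℕ => groundStateEnergy lennardJones 3 N / N) atTop (𝓝 e) →
      ∀ R : ℝ, R₁ ≤ R → ∀ᶠ N in atTop,
        (∃ c : Fin N,
          (∃ q : E3, dist q (x N c) ≤ R ∧ (∀ k : Fin N, 9 / 10 ≤ dist q (x N k)) ∧
            10 ≤ (Finset.univ.filter fun k : Fin N => 39 / 40 ≤ dist q (x N k) ∧ dist q (x N k) ≤ 103 / 100).card) ∨
          (∃ i : Fin N, dist (x N i) (x N c) ≤ R ∧ 1 / 100 ≤ siteEnergy lennardJones (x N) i)) →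
        ∃ (c : Fin N) (M : ℕ) (z : Fin M → E3), Function.Injective z ∧
          (∀ k : Fin N, R < dist (x N k) (x N c) → x N k ∈ Set.range z) ∧
          (∀ l : Fin M, R < dist (z l) (x N c) → z l ∈ Set.range (x N)) ∧
          N ≤ M + ⌈64 * R ^ 3⌉₊ ∧ M ≤ N + ⌈64 * R ^ 3⌉₊ ∧
          interactionEnergy lennardJones z + 1 / 100 ≤ interactionEnergy lennardJones (x N) + e * ((M : ℝ) - N) := by
  refine ⟨1 / 100, 1, by norm_num, fun e he R hR => Filter.Eventually.of_forall fun N hdef => ?_⟩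
  have hR0 : 0 < R := by linarith
  obtain ⟨c, hc⟩ := hdef
  rcases hc with ⟨q, hqc, hclear, hcaged⟩ | ⟨i, hic, hhot⟩
  · exact ⟨c, improvable_of_cagedHole (hx N) hR0 hqc hclear hcaged (twoConeB_le_of_tendsto he) le_rfl⟩
  · exact ⟨c, improvable_of_hotSite (hx N) hR0 hic hhot (level_nonpos_of_tendsto he) le_rfl⟩

end Summit.AtomisticToContinuum.Crystallization.Theorems.LoopTunnelDialOrderOneRung
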